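import Summits.Ventures.PercRepro.PerFlatHall
import Summits.Ventures.PercRepro.OrbitK
import Mathlib.Combinatorics.Hall.Basic

/-!
# PercRepro — the per-flat route of C-025 is EXACTLY a Hall condition on the rank-`q` flats, part B: the Hall
condition GIVES a certificate (night-4, gen 2; part A = `PerFlatHall.lean`)

`PerFlatHall.lean` defines the Hall condition `Hall M p q c` (for every family `𝒢` of rank-`q` flats,
`c · #UqFam(𝒢) ≤ #nbhd(𝒢)`) and shows that every per-flat certificate supported on adjacency satisfies it.  This
file proves the converse with Mathlib's Hall marriage theorem (`Finset.all_card_le_biUnion_card_iff_exists_injective`)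
for `c = a / b`: take `a` copies of every bottom set (`Copies`) and `b` copies of every middle-level set, let a copy of
`B` be matchable to the copies of the sets adjacent to `cl(B)` (`partners`); the marriage condition for a set `s` of
copies is `#s ≤ a · #UqFam(famOf s) ≤ b · #nbhd(famOf s) ≤ #(⋃ partners)` (`marriage_condition`), the matching `f` it
produces gives the weighting `certOf f` (the number of copies of the bottom sets of `G` matched to a copy of `S`,
divided by `b`), and `certOf f` is a certificate (`exists_cert_of_hall`).  Hence:

* `hall_iff_exists_cert`: for `c = a / b` (`0 < b`) a certificate exists iff the Hall condition holds;
* `hall_iff_exists_cert_phiK`: the same with `c = Φ(p, q)` (a ratio of naturals, `phiK_eq_div`);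
* `c025_of_hall_phiK`: C-025's core from `Hall M p q (Φ(p, q))`.

Imports: part A, `OrbitK` (for `phiK`) and Mathlib's `Hall/Basic`.
-/

namespace PercRepro.PerFlat

open Finset ThmH

variable {α : Type*} [DecidableEq α] {M : Matroid α} [M.Finite]

/-- Filtering an `attach` by a predicate on the value. -/
theorem card_filter_attach_val {β : Type*} (s : Finset β) (P : β → Prop) [DecidablePred P] :
    (s.attach.filter (fun x => P x.1)).card = (s.filter P).card := by
  conv_rhs => rw [← Finset.attach_map_val (s := s)]
  rw [Finset.filter_map, Finset.card_map]
  rfl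

/-- The `a` copies of the bottom sets of `(p, q)`. -/
abbrev Copies (M : Matroid α) [M.Finite] (p q a : ℕ) : Type _ :=
  {x : Finset α × Fin a // x ∈ (Uq M p q) ×ˢ (Finset.univ : Finset (Fin a))}

open scoped Classical in
/-- The candidate partners of a copy of `B`: the `b` copies of the middle-level sets adjacent to `cl(B)`. -/
noncomputable def partners (M : Matroid α) [M.Finite] (p q b : ℕ) (B : Finset α) : Finset (Finset α × Fin b) :=
  ((Yq M p q).filter (fun S => Adj M q (clF M B) S)) ×ˢ (Finset.univ : Finset (Fin b))

open scoped Classical in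
/-- Membership in `partners`. -/
theorem mem_partners {p q b : ℕ} {B : Finset α} {z : Finset α × Fin b} :
    z ∈ partners M p q b B ↔ z.1 ∈ Yq M p q ∧ Adj M q (clF M B) z.1 := by
  unfold partners
  rw [Finset.mem_product, Finset.mem_filter]
  exact ⟨fun h => h.1, fun h => ⟨h, Finset.mem_univ _⟩⟩

/-- The family of flats spanned by a set of copies. -/
noncomputable def famOf {p q a : ℕ} (s : Finset (Copies M p q a)) : Finset (Finset α) :=
  (s.map (Function.Embedding.subtype _)).image (fun x => clF M x.1)

/-- `famOf s ⊆ flatsQ`. -/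
theorem famOf_subset {p q a : ℕ} (s : Finset (Copies M p q a)) : famOf s ⊆ flatsQ M q := by
  intro G hG
  unfold famOf at hG
  rw [Finset.mem_image] at hG
  obtain ⟨x, hx, rfl⟩ := hG
  rw [Finset.mem_map] at hx
  obtain ⟨y, -, rfl⟩ := hx
  have hy := y.2
  rw [Finset.mem_product] at hy
  exact clF_mem_flatsQ hy.1

/-- `#s ≤ a · #UqFam(famOf s)`. -/
theorem card_copies_le {p q a : ℕ} (s : Finset (Copies M p q a)) :
    s.card ≤ a * (UqFam M p q (famOf s)).card := by
  have hsub : s.map (Function.Embedding.subtype _) ⊆ (UqFam M p q (famOf s)) ×ˢ (Finset.univ : Finset (Fin a)) := by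
    intro x hx
    rw [Finset.mem_product]
    refine ⟨?_, Finset.mem_univ _⟩
    rw [mem_UqFam]
    have hx' := hx
    rw [Finset.mem_map] at hx'
    obtain ⟨y, -, rfl⟩ := hx'
    have hy := y.2
    rw [Finset.mem_product] at hy
    refine ⟨hy.1, ?_⟩
    unfold famOf
    rw [Finset.mem_image]
    exact ⟨y.1, hx, rfl⟩
  have h := Finset.card_le_card hsub
  rw [Finset.card_product, Finset.card_univ, Fintype.card_fin, Finset.card_map] at h
  linarith [h]

/-- `b · #nbhd(famOf s) ≤ #(⋃_{x ∈ s} partners x)`. -/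
theorem card_nbhd_le_biUnion {p q a b : ℕ} (s : Finset (Copies M p q a)) :
    b * (nbhd M p q (famOf s)).card ≤ (s.biUnion (fun x => partners M p q b x.1.1)).card := by
  have hsub : (nbhd M p q (famOf s)) ×ˢ (Finset.univ : Finset (Fin b)) ⊆
      s.biUnion (fun x => partners M p q b x.1.1) := by
    intro z hz
    rw [Finset.mem_product] at hz
    obtain ⟨hS, -⟩ := hz
    rw [mem_nbhd] at hS
    obtain ⟨hSY, G, hG, hadj⟩ := hS
    unfold famOf at hG
    rw [Finset.mem_image] at hG
    obtain ⟨x, hx, rfl⟩ := hG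
    rw [Finset.mem_map] at hx
    obtain ⟨y, hy, rfl⟩ := hx
    rw [Finset.mem_biUnion]
    refine ⟨y, hy, ?_⟩
    rw [mem_partners]
    exact ⟨hSY, hadj⟩
  have h := Finset.card_le_card hsub
  rw [Finset.card_product, Finset.card_univ, Fintype.card_fin] at h
  linarith [h]

/-- **The marriage condition** for `a` copies of the bottom sets against `b` copies of the middle-level sets follows
from `Hall M p q (a / b)`. -/
theorem marriage_condition {p q a b : ℕ} (hb : 0 < b) (h : Hall M p q ((a : ℚ) / b))
    (s : Finset (Copies M p q a)) : s.card ≤ (s.biUnion (fun x => partners M p q b x.1.1)).card := by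
  have h1 := card_copies_le s
  have h3 := card_nbhd_le_biUnion (b := b) s
  have h2 : a * (UqFam M p q (famOf s)).card ≤ b * (nbhd M p q (famOf s)).card := by
    have hh := h (famOf s) (famOf_subset s)
    have hb' : (0 : ℚ) < b := by exact_mod_cast hb
    rw [div_mul_eq_mul_div, div_le_iff₀ hb'] at hh
    have hh' : ((a * (UqFam M p q (famOf s)).card : ℕ) : ℚ) ≤ ((b * (nbhd M p q (famOf s)).card : ℕ) : ℚ) := by
      push_cast
      linarith [hh]
    exact_mod_cast hh'
  omega

/-- The weighting extracted from a matching `f`: `w(G, S)` = the number of copies `(B, i)` with `cl(B) = G` matched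
to a copy of `S`, divided by `b`. -/
noncomputable def certOf {p q a b : ℕ} (f : Copies M p q a → Finset α × Fin b) (G S : Finset α) : ℚ :=
  ((((Uq M p q) ×ˢ (Finset.univ : Finset (Fin a))).attach.filter
    (fun x => clF M x.1.1 = G ∧ (f x).1 = S)).card : ℚ) / b

/-- **The Hall condition gives a per-flat certificate** (`c = a / b`, `0 < b`): Mathlib's Hall marriage theorem
matches the `a` copies of every bottom set injectively to copies of adjacent middle-level sets, and `certOf` is the
resulting weighting. -/
theorem exists_cert_of_hall {p q a b : ℕ} (hb : 0 < b) (h : Hall M p q ((a : ℚ) / b)) :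
    ∃ w : Finset α → Finset α → ℚ, IsCert M p q ((a : ℚ) / b) w := by
  classical
  obtain ⟨f, hfinj, hft⟩ :=
    (Finset.all_card_le_biUnion_card_iff_exists_injective
      (fun x : Copies M p q a => partners M p q b x.1.1)).1 (marriage_condition hb h)
  have hb' : (0 : ℚ) < b := by exact_mod_cast hb
  refine ⟨certOf f, ?_, ?_, ?_, ?_⟩
  · intro G S
    unfold certOf
    positivity
  · intro G _ S hadj
    unfold certOf
    rw [div_eq_zero_iff]
    left
    norm_cast
    rw [Finset.card_eq_zero, Finset.filter_eq_empty_iff]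
    intro x _ hx
    obtain ⟨hG, hS⟩ := hx
    have := (mem_partners.1 (hft x)).2
    rw [hG, hS] at this
    exact hadj this
  · intro S _
    unfold certOf
    rw [← Finset.sum_div, div_le_one hb']
    -- the matched copies of `S` number at most `b` (injectivity into `{S} × Fin b`)
    have hfib : ∑ G ∈ flatsQ M q, ((((Uq M p q) ×ˢ (Finset.univ : Finset (Fin a))).attach.filter
        (fun x => clF M x.1.1 = G ∧ (f x).1 = S)).card : ℚ) =
        ((((Uq M p q) ×ˢ (Finset.univ : Finset (Fin a))).attach.filter (fun x => (f x).1 = S)).card : ℚ) := by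
      norm_cast
      rw [Finset.card_eq_sum_card_fiberwise (f := fun x : Copies M p q a => clF M x.1.1) (t := flatsQ M q)]
      · apply Finset.sum_congr rfl
        intro G _
        rw [Finset.filter_filter]
        congr 1
        ext x
        simp only [Finset.mem_filter]
        tauto
      · intro x hx
        have hy := x.2
        rw [Finset.mem_product] at hy
        exact clF_mem_flatsQ hy.1
    rw [hfib]
    have hinj : (((Uq M p q) ×ˢ (Finset.univ : Finset (Fin a))).attach.filter (fun x => (f x).1 = S)).card ≤
        (({S} : Finset (Finset α)) ×ˢ (Finset.univ : Finset (Fin b))).card := by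
      apply Finset.card_le_card_of_injOn f
      · intro x hx
        rw [Finset.mem_coe, Finset.mem_filter] at hx
        rw [Finset.mem_coe, Finset.mem_product, Finset.mem_singleton]
        exact ⟨hx.2, Finset.mem_univ _⟩
      · intro x _ y _ hxy
        exact hfinj hxy
    rw [Finset.card_product, Finset.card_singleton, Finset.card_univ, Fintype.card_fin, one_mul] at hinj
    exact_mod_cast hinj
  · intro G hG
    unfold certOf
    rw [← Finset.sum_div, le_div_iff₀ hb']
    -- the copies of the bottom sets of `G` number `a · #UqG(G)`, and every one is matched to some `S ∈ Yq`
    have hfib : ∑ S ∈ Yq M p q, ((((Uq M p q) ×ˢ (Finset.univ : Finset (Fin a))).attach.filter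
        (fun x => clF M x.1.1 = G ∧ (f x).1 = S)).card : ℚ) =
        ((((Uq M p q) ×ˢ (Finset.univ : Finset (Fin a))).attach.filter (fun x => clF M x.1.1 = G)).card : ℚ) := by
      norm_cast
      rw [Finset.card_eq_sum_card_fiberwise (f := fun x : Copies M p q a => (f x).1) (t := Yq M p q)]
      · apply Finset.sum_congr rfl
        intro S _
        rw [Finset.filter_filter]
      · intro x _
        exact (mem_partners.1 (hft x)).1
    have hcount : (((Uq M p q) ×ˢ (Finset.univ : Finset (Fin a))).attach.filter
        (fun x => clF M x.1.1 = G)).card = (UqG M p q G).card * a := by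
      have hh := card_filter_attach_val ((Uq M p q) ×ˢ (Finset.univ : Finset (Fin a)))
        (fun y : Finset α × Fin a => clF M y.1 = G)
      have hh2 := Finset.filter_product_left (s := Uq M p q) (t := (Finset.univ : Finset (Fin a)))
        (fun B : Finset α => clF M B = G)
      rw [hh, hh2, Finset.card_product, Finset.card_univ, Fintype.card_fin, ← UqG_eq_filter_clF hG]
    rw [hfib, hcount]
    push_cast
    rw [div_mul_eq_mul_div, div_mul_cancel₀ _ hb'.ne']
    apply le_of_eq
    ring

/-- **The per-flat route is exactly the Hall condition**: for `c = a / b` with `0 < b`, a certificate exists iff the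
Hall condition holds. -/
theorem hall_iff_exists_cert {p q a b : ℕ} (hb : 0 < b) :
    Hall M p q ((a : ℚ) / b) ↔ (∃ w : Finset α → Finset α → ℚ, IsCert M p q ((a : ℚ) / b) w) := by
  constructor
  · exact exists_cert_of_hall hb
  · rintro ⟨w, hw⟩
    exact hall_of_cert (by positivity) hw

/-- `Φ(p, q)` is a ratio of naturals with a positive denominator. -/
theorem phiK_eq_div (p q : ℕ) :
    phiK p q = ((∑ u ∈ Finset.Ioo q p, Nat.choose (p + q) u : ℕ) : ℚ) / ((Nat.choose (p + q) p : ℕ) : ℚ) := by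
  unfold phiK
  push_cast
  rfl

/-- **The per-flat route of C-025 at `(p, q)` is exactly `Hall M p q (Φ(p, q))`**: a certificate with the constant
`Φ(p, q)` exists iff the Hall condition holds with that constant. -/
theorem hall_iff_exists_cert_phiK (p q : ℕ) :
    Hall M p q (phiK p q) ↔ (∃ w : Finset α → Finset α → ℚ, IsCert M p q (phiK p q) w) := by
  rw [phiK_eq_div]
  exact hall_iff_exists_cert (Nat.choose_pos (by omega))

/-- **C-025's core at `(p, q)` from the Hall condition with `Φ(p, q)`**, in the spelling of `C025`. -/
theorem c025_of_hall_phiK {p q : ℕ} (h : Hall M p q (phiK p q)) :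
    phiK p q * ({A : Set α | A ⊆ M.E ∧ M.eRk A = (p : ℕ∞) ∧ M.eRk (M.E \ A) = (q : ℕ∞)}.ncard : ℚ) ≤
      ({A : Set α | A ⊆ M.E ∧ (q : ℕ∞) < M.eRk A ∧ M.eRk A < (p : ℕ∞)}.ncard : ℚ) :=
  c025_of_hall h

end PercRepro.PerFlat
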